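import Summits.QuantumFields.YangMills.Theorems.BalabanUVNodesK0AxTangentSocketOnto
import Summits.QuantumFields.YangMills.Theorems.BalabanUVNodesK0AxTangentSocketModGauge

/-!
# NODE O · K0ᴬ — THE (R-a) ROAD's `_modGauge` TWINS AT THE def-Y JUNCTION AND AT THE SCHEME OF RECORD
# (the CONTENTFUL editions of ✓`rootedReceipts_of_tokens_atScale_lieExpo` ∕ ✓`…_recordScheme`)

Porter ▶ PTC-1 g4 (unit `ymgap-nodeO-port-PTC-1`, 2026-08-31; helper `--supports stmt-QuantumFields-27238 --as helper`, NO `--workitem`).  AUTHORSHIP: this leaf is the porter's own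
pen executing ◇ lens-1 g11's RESULT∕DONE handoff item (2) VERBATIM (nodeO STATUS 2026-08-31T12:56:46Z: «NEW theorems `…_lieExpo_modGauge` ∕ `…_recordScheme_modGauge` = ✓Onto :207∕:263 with
the `…_onto … Jcrit Jcons` call replaced by `…_modGauge … hρ8` (never delete the old vacuous pair)») as priced by ◆ CRIT-1 g38 (12:56:21Z ∕ 13:02:38Z: «the four earlier Ψ₀ finals … stay
VACUOUS-AS-TYPED until the `_modGauge` twins of `_lieExpo`∕`_recordScheme` are appended — porter∕successor lane»).  No new definition, no new letter; every step is a tree theorem by name.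
◆ CRIT-1 g38's CUT + J-STAMP (nodeO STATUS 2026-08-31T13:07:25Z): «GO VERBATIM; axioms std × 2; J5′ no def; J4 2 × 0; MECHANICAL BINDER CUSTODY against the TREE:
`…_lieExpo_modGauge` vs ✓Onto `…_lieExpo` — 24 vs 25 binders, ONLY-in-Onto {Jcrit, Jcons}, ONLY-here {hρ8}, conclusion EQUAL; `…_recordScheme_modGauge` vs ✓Onto `…_recordScheme` —
30 vs 32, ONLY-in-Onto {hρ, Jcrit, Jcons}, ONLY-here {hρ8}, conclusion EQUAL; J-STAMP on both finals: NON-VACUOUS-AS-TYPED modulo the displayed tokens; `_thetaFill` edition NOT wanted».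

WHY.  The tree's ✓`rootedReceipts_of_tokens_atScale_lieExpo` (✓p822694 :207) and ✓`…_recordScheme` (:263) take the binders `Jcrit : FlatCritDictionary … Ψ₀` and
`Jcons : FlatConsDictionary … Ψ₀ _` at the canonical flat logarithmic chart `Ψ₀ := msChart F 2 K (k+1) (atScale (k+1)) (avgFamily (avOfRecord F 2 K) 1) 1`.  `Jcons` is
UNINHABITABLE there (✓`not_flatConsDictionary_msChart_flat[_of_le]`, ◆'s ruling REFUTED-MISSTATED), so both finals are VACUOUS-AS-TYPED.  ✓`…K0AxTangentSocketModGauge`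
(◇ CANDIDATE 9 = FILE 11) re-typed the road's final WITHOUT either dictionary — (J-crit′)@Ψ₀ is ★★ DEF-1's ✓`flatCritDictionary_flatLogChart`, (J-cons″)@Ψ₀ is the theorem
✓`flatConsModGauge_msChart_flat` — at the price of ONE displayed side condition `hρ8 : ∀ v, θ.ρ8 v ∈ 𝔰𝔲(2)` (FREE at the record's fill: ✓`PortU8.ρ8_thetaFill_mem_lieSU`).  This leaf
threads that contentful final through the two junction editions:

* ★★★ `rootedReceipts_of_tokens_atScale_lieExpo_modGauge` — the def-Y JUNCTION (`X := S.lieExpo ∘ unitField`): binders = ✓`…_lieExpo`'s MINUS `Jcrit Jcons` PLUS `hρ8`; proof =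
  ✓`…_lieExpo`'s with the last call re-pointed to ✓`rootedReceipts_of_tokens_atScale_flatLogChart_modGauge`.
* ★★★★ `rootedReceipts_of_tokens_atScale_recordScheme_modGauge` — the SCHEME OF RECORD (`S = bgSchemeOfRecord F 2 K (k+1) Ω 1 dom …`, binders VERBATIM ✓`…_recordScheme`'s MINUS
  `Jcrit Jcons hρ` PLUS `hρ8`): the chart letter `exp (ρ₈ v) ∈ SU(2)` of ✓`…_recordScheme` is DERIVED from `hρ8` by ✓`T4AdjointCovarianceUnitary.exp_mem_specialUnitaryGroup_of_mem_lieSU`,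
  so the displayed list SHRINKS by two letters and changes one (`hρ` ↦ `hρ8`, both true at the fill).
  At the record's fill `θ := thetaFill F a₀ ε₂₉` the added `hρ8` is discharged BY NAME (✓`PortU8.ρ8_thetaFill_mem_lieSU F a₀ ε₂₉`), so a consumer there displays no chart letter at all.

WHAT STAYS DISPLAYED (inhabited NOWHERE as a package — the wall, unchanged): N07's KNIT tokens `(Kc range covers sol_of_isMinOn star_mem star_isMinOn)`, `RegimeTok`, the domain letter ∕
`dom ∈ 𝓝 1`, `WAnalyticTok`, `0 < a𝔄`, the scheme's flat-background ∕ Lie letters (`hbg htok hsol1 h𝔄1 hev hC2` resp. the eventual Lie token `htok` at the record scheme), `k + 2 ≤ m + K`.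
HONEST: bookkeeping — two `exact`s over tree theorems; CONDITIONAL finals over DISPLAYED letters; nothing of Bałaban ([15] Thm 1, Prop. 4, 6–9, (44)–(48), (82)–(83), (115)–(117),
(176)–(182); [I] (1.20), (4.35)) asserted, ported, discharged or refuted; (C-tab-opt) STRUCK; K0ᴬ stmt-QuantumFields-27238 ∕ K0⁷ 20541 OPEN — NOTHING of them proved; NODE O 0∕1;
COUNT 8∕28 · K 1∕4 UNMOVED; finite 𝕋⁴_{L^K} at fixed ε — NOT continuum ∕ OS ∕ Clay; **the Yang–Mills mass gap is NOT proved by any of this.**  No `sorry`, no `def`, no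
`instance ∕ notation ∕ set_option`; standard axioms.
-/

noncomputable section

open Filter Topology
open scoped BigOperators Matrix.Norms.L2Operator
open scoped InnerProductSpace

namespace Summit.QuantumFields.YangMills.Theorems.K0AxCtabUniq

open Literature.MathematicalPhysics.QuantumFieldTheory.Balaban1983to89
open LatticeFieldCalculus B6SectADomainsV1 B6SectAOperatorsV1 B6SectAVectorModelV1 B6SectACriticalPointV1
open Literature.MathematicalPhysics.QuantumFieldTheory.Balaban1983to89.T4Continuum (T4Family)
open Literature.MathematicalPhysics.QuantumFieldTheory.Balaban1983to89.Node00
open T4RootedResidualGauge (rootGauge)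
open GaugeField (gaugeAct)
open B12GaugeOrbits021 (IsResidual OrbitRel)
open B11Prop6Scheme (mapT)
open Summit.QuantumFields.YangMills.Theorems.K0RecordFormatNames
open Summit.QuantumFields.YangMills.Theorems.K0AxRootGrad
open T4AdjointCovarianceUnitary (lieSU expSU coe_expSU exp_mem_specialUnitaryGroup_of_mem_lieSU)
open B15DeterminingSets (DetSet MSField AgreeOn avgFamily atScale agreeOn_atScale_iff)
open B11Eq103H1Complex (BondL2K SiteL2K)

variable (F : T4Family) (θ : Stage13Params F 2)

/-! ## §1  The def-Y junction, contentful edition -/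

section LieJunctionModGauge

/-- ★★★ **THE (R-a) ROAD AT THE def-Y JUNCTION — CONTENTFUL EDITION** (`k + 2 ≤ m + K`; `X := S.lieExpo ∘ unitField`): ✓`rootedReceipts_of_tokens_atScale_lieExpo` with the
vacuous dictionary binders `Jcrit`∕`Jcons` REMOVED and the chart side condition `ρ₈ ∈ 𝔰𝔲(2)` ADDED; the final call is ✓`rootedReceipts_of_tokens_atScale_flatLogChart_modGauge`
((J-crit′)@Ψ₀ by ★★ DEF-1's ✓`flatCritDictionary_flatLogChart`, (J-cons″)@Ψ₀ by ✓`flatConsModGauge_msChart_flat`, both inside).  DISPLAYED: the KNIT tokens + `RegimeTok` + domain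
letter; `S.bg (unitField B) = 1`; the eventual Lie token along `unitField`; `S.sol 1 = 0`, `S.𝔄 1 = 0`; continuity of `S.ev`; `C²` of `B ↦ 𝒜(unitField B) + 𝔄(unitField B)` at `0`;
`ρ₈ ∈ 𝔰𝔲(2)`.  ⟹ (∀ a l, the four rooted receipts) ∧ TokP9reg♭ᵣ — NON-VACUOUS modulo the displayed tokens.  CONDITIONAL; nothing of [15] asserted.
[cite: Balaban1985Variational, (15) p.280, (19)–(20) p.281, (44)–(48) p.285, Prop. 6 p.295, (82)–(83) p.290, Prop. 9 p.309, (177)–(182) pp.306–307; Balaban1985RegularSpaces, (1.113)–(1.114) pp.95–97; Balaban1988Convergent, (2.10)–(2.13) pp.256–257] -/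
theorem rootedReceipts_of_tokens_atScale_lieExpo_modGauge {𝒴 𝒵 : Type} [NormedAddCommGroup 𝒴] [NormedSpace ℂ 𝒴] [CompleteSpace 𝒴] [NormedAddCommGroup 𝒵] [NormedSpace ℂ 𝒵]
    (k K : ℕ) (hk2 : k + 2 ≤ (F.P K).m + (F.P K).K) (S : BgScheme F 2 𝒴 𝒵 K (k + 1))
    (hR : S.RegimeTok) (Kc : GaugeField (F.P K) (k + 1) (SU 2) → Set 𝒴)
    (range : ∀ V ∈ S.dom, ∀ A ∈ Kc V, S.chart V A ∈ bgReg F 2 K (k + 1) θ.εbg ∧ Averaging.iter (avOfRecord F 2 K) (k + 1) (S.chart V A) = V)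
    (covers : ∀ V ∈ S.dom, ∀ U : GaugeField (F.P K) 0 (SU 2), U ∈ bgReg F 2 K (k + 1) θ.εbg →
      Averaging.iter (avOfRecord F 2 K) (k + 1) U = V → ∃ A ∈ Kc V, OrbitRel (k + 1) (S.chart V A) U)
    (sol_of_isMinOn : ∀ V ∈ S.dom, ∀ A ∈ Kc V, IsMinOn (wilsonAction4 ∘ S.chart V) (Kc V) A →
      ‖A‖ ≤ S.ε₄ ∧ mapT (S.𝒢 V) 0 (S.W V) (S.J V) (S.𝔄 V) A = A)
    (star_mem : ∀ V ∈ S.dom, S.sol V ∈ Kc V) (star_isMinOn : ∀ V ∈ S.dom, IsMinOn (wilsonAction4 ∘ S.chart V) (Kc V) (S.sol V))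
    (hdom : letI := θ.instVβ₁; letI := θ.instVβ₂;
      ∀ᶠ B in 𝓝 (0 : Fin (F.P K).d → Site (F.P K) (k + 1) → θ.Vβ), unitField F θ k K B ∈ S.dom)
    (hbg : ∀ B, S.bg (unitField F θ k K B) = 1)
    (htok : letI := θ.instVβ₁; letI := θ.instVβ₂;
      ∀ᶠ B in 𝓝 (0 : Fin (F.P K).d → Site (F.P K) (k + 1) → θ.Vβ), S.LieTokAt (unitField F θ k K B))
    (hsol1 : S.sol 1 = 0) (h𝔄1 : S.𝔄 1 = 0) (hev : Continuous S.ev)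
    (hC2 : letI := θ.instVβ₁; letI := θ.instVβ₂;
      ContDiffAt ℝ 2 (fun B : Fin (F.P K).d → Site (F.P K) (k + 1) → θ.Vβ => S.sol (unitField F θ k K B) + S.𝔄 (unitField F θ k K B)) 0)
    (hρ8 : letI := θ.instVβ₁; letI := θ.instVβ₂; ∀ v : θ.Vβ, θ.ρ8 v ∈ lieSU (Fin 2)) :
    (∀ (a : θ.ιβ) (l : RespLabel F k K),
      RootedResponseCriticalModGaugeAt F θ k K a l ∧ RootedResponseOrbitAt F θ k K a l ∧
        RootedResponseInvCriticalAt F θ k K a l ∧ RootedResponseConstraintModGaugeAt F θ k K a l) ∧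
    letI := θ.instVβ₁; letI := θ.instVβ₂
    ContDiffAt ℝ 2 (fun B : Fin (F.P K).d → Site (F.P K) (k + 1) → θ.Vβ =>
      fun (b : PBond (F.P K) 0) (i i' : Fin 2) => ((recordBgField F θ k K B b : SU 2) : Matrix (Fin 2) (Fin 2) ℂ) i i') 0 := by
  letI := θ.instVβ₁; letI := θ.instVβ₂
  obtain ⟨W, hW⟩ := exists_datumFamily_unitField F θ k K
  have hX₀ : S.lieExpo (unitField F θ k K 0) = 0 := by
    rw [PortU8.unitField_zero F θ k K]
    exact BgScheme.lieExpo_eq_zero hsol1 h𝔄1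
  exact rootedReceipts_of_tokens_atScale_flatLogChart_modGauge F θ k K hk2 S hR Kc range covers sol_of_isMinOn star_mem star_isMinOn hdom W hW
    (fun B => S.lieExpo (unitField F θ k K B)) (BgScheme.chartCfg_comp_eventuallyEq_expChart hbg htok) hX₀ (BgScheme.contDiffAt_lieExpo_comp hev hC2) hρ8

end LieJunctionModGauge

/-! ## §2  The scheme of record, contentful edition -/

section RecordSchemeModGauge

/-- ★★★★ **THE (R-a) ROAD AT THE SCHEME OF RECORD — CONTENTFUL EDITION** (`S = bgSchemeOfRecord F 2 K (k+1) Ω 1 dom levB Gp Δ2 a hposπ hposb hQ εC B₀ C₄ a₃ j a𝔄 ε₄`,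
binders VERBATIM ✓`rootedReceipts_of_tokens_atScale_recordScheme` MINUS the vacuous dictionary binders `Jcrit`∕`Jcons` and MINUS the chart letter `exp (ρ₈ v) ∈ SU(2)` — the latter
is DERIVED from the one added side condition `ρ₈ ∈ 𝔰𝔲(2)` by ✓`T4AdjointCovarianceUnitary.exp_mem_specialUnitaryGroup_of_mem_lieSU`).  DISPLAYED: N07's KNIT tokens of the record scheme;
def-Y's standing letters `RegimeTok`, `WAnalyticTok`, `0 < a𝔄`, `dom ∈ 𝓝 1`; the Lie token eventually along `unitField`; `ρ₈ ∈ 𝔰𝔲(2)` (TRUE at the record's fill,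
✓`PortU8.ρ8_thetaFill_mem_lieSU`).  READ BY NAME from def-Y (✓`…K0AxSchemeOfRecordLetters` §3): the domain letter, (s-exp), `X 0 = 0`, `X ∈ C²`; the
contentful Ψ₀-final ✓`rootedReceipts_of_tokens_atScale_flatLogChart_modGauge`.  ⟹ (∀ a l, the four rooted receipts) ∧ TokP9reg♭ᵣ — NON-VACUOUS modulo the displayed tokens.
CONDITIONAL on the displayed letters, inhabited nowhere as a package; nothing of [15] asserted. [cite: Balaban1985Variational, Prop. 6 (115)–(117) p.295, Prop. 4 p.292, Prop. 9 p.309, (15) p.280, (19)–(20) p.281, (44)–(48) p.285, (82)–(83) p.290, (177)–(182) pp.306–307; Balaban1985RegularSpaces, (1.113)–(1.114) pp.95–97; Balaban1988Convergent, (2.10)–(2.13) pp.256–257; Balaban1987RG1, p.264 (before (1.20))] -/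
theorem rootedReceipts_of_tokens_atScale_recordScheme_modGauge (k K : ℕ) (hk2 : k + 2 ≤ (F.P K).m + (F.P K).K)
    [Fact (0 < (F.L : ℝ))] [Fact (0 < (F.P K).eta (k + 1))] [Fact (0 < c0Rec F K (k + 1))] [Fact (∀ c, 0 < wBRec F K (k + 1) c)]
    (Ω : ℕ → Set (Site (F.P K) 0)) (dom : Set (GaugeField (F.P K) (k + 1) (SU 2))) (levB : PBond (F.P K) (k + 1) → ℕ)
    (Gp : SiteL2K ℂ (F.P K).d (fun _ => (F.P K).sitesPerDir 0) (c0Rec F K (k + 1)) (WRec 2) →ₗ[ℂ]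
      SiteL2K ℂ (F.P K).d (fun _ => (F.P K).sitesPerDir 0) (c0Rec F K (k + 1)) (WRec 2))
    (Δ2 : BondL2K ℂ (F.P K).d (fun _ => (F.P K).sitesPerDir 0) (c0Rec F K (k + 1)) (WRec 2) →ₗ[ℂ]
      BondL2K ℂ (F.P K).d (fun _ => (F.P K).sitesPerDir 0) (c0Rec F K (k + 1)) (WRec 2)) (a : ℝ)
    (hposπ : ∀ x, x ≠ 0 → 0 < RCLike.re ⟪x, laplaceAOfRecordAt F 2 (k + 1) (1 : GaugeField (F.P K) 0 (SU 2))
      (hessOpOfRecord128 F 2 (k + 1) (1 : GaugeField (F.P K) 0 (SU 2)) Gp (QflatOfRecord F 2 (k + 1)) Δ2)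
      (QOfRecord F 2 (k + 1) (1 : GaugeField (F.P K) 0 (SU 2))) (QflatOfRecord F 2 (k + 1)) a x⟫_ℂ)
    (hposb : ∀ x, x ≠ 0 → 0 < RCLike.re ⟪x, laplaceAOfRecord F 2 (k + 1) (1 : GaugeField (F.P K) 0 (SU 2))
      (QOfRecord F 2 (k + 1) (1 : GaugeField (F.P K) 0 (SU 2))) (QflatOfRecord F 2 (k + 1)) a x⟫_ℂ)
    (hQ : Function.Surjective (QOfRecord F 2 (k + 1) (1 : GaugeField (F.P K) 0 (SU 2)))) (εC B₀ C₄ a₃ j a𝔄 ε₄ : ℝ)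
    (S : BgSchemeOnLit F 2 K (k + 1) Ω 1) (hS : S = bgSchemeOfRecord F 2 K (k + 1) Ω 1 dom levB Gp Δ2 a hposπ hposb hQ εC B₀ C₄ a₃ j a𝔄 ε₄)
    (hT : S.RegimeTok) (hWtok : WAnalyticTok F 2 K (k + 1) Ω 1 levB Gp a hposb hQ εC a₃) (ha𝔄 : 0 < a𝔄)
    (hd : dom ∈ 𝓝 (1 : GaugeField (F.P K) (k + 1) (SU 2)))
    (hρ8 : letI := θ.instVβ₁; letI := θ.instVβ₂; ∀ v : θ.Vβ, θ.ρ8 v ∈ lieSU (Fin 2))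
    (Kc : GaugeField (F.P K) (k + 1) (SU 2) → Set (Space115Lit F 2 K (k + 1) Ω 1))
    (range : ∀ V ∈ S.dom, ∀ A ∈ Kc V, S.chart V A ∈ bgReg F 2 K (k + 1) θ.εbg ∧ Averaging.iter (avOfRecord F 2 K) (k + 1) (S.chart V A) = V)
    (covers : ∀ V ∈ S.dom, ∀ U : GaugeField (F.P K) 0 (SU 2), U ∈ bgReg F 2 K (k + 1) θ.εbg →
      Averaging.iter (avOfRecord F 2 K) (k + 1) U = V → ∃ A ∈ Kc V, OrbitRel (k + 1) (S.chart V A) U)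
    (sol_of_isMinOn : ∀ V ∈ S.dom, ∀ A ∈ Kc V, IsMinOn (wilsonAction4 ∘ S.chart V) (Kc V) A →
      ‖A‖ ≤ S.ε₄ ∧ mapT (S.𝒢 V) 0 (S.W V) (S.J V) (S.𝔄 V) A = A)
    (star_mem : ∀ V ∈ S.dom, S.sol V ∈ Kc V) (star_isMinOn : ∀ V ∈ S.dom, IsMinOn (wilsonAction4 ∘ S.chart V) (Kc V) (S.sol V))
    (htok : letI := θ.instVβ₁; letI := θ.instVβ₂;
      ∀ᶠ B in 𝓝 (0 : Fin (F.P K).d → Site (F.P K) (k + 1) → θ.Vβ), S.LieTokAt (unitField F θ k K B)) :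
    (∀ (a : θ.ιβ) (l : RespLabel F k K),
      RootedResponseCriticalModGaugeAt F θ k K a l ∧ RootedResponseOrbitAt F θ k K a l ∧
        RootedResponseInvCriticalAt F θ k K a l ∧ RootedResponseConstraintModGaugeAt F θ k K a l) ∧
    letI := θ.instVβ₁; letI := θ.instVβ₂
    ContDiffAt ℝ 2 (fun B : Fin (F.P K).d → Site (F.P K) (k + 1) → θ.Vβ =>
      fun (b : PBond (F.P K) 0) (i i' : Fin 2) => ((recordBgField F θ k K B b : SU 2) : Matrix (Fin 2) (Fin 2) ℂ) i i') 0 := by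
  letI := θ.instVβ₁; letI := θ.instVβ₂
  subst hS
  have h1 : (1 : GaugeField (F.P K) (k + 1) (SU 2)) ∈ dom := mem_of_mem_nhds hd
  have hρ : ∀ v : θ.Vβ, NormedSpace.exp (θ.ρ8 v) ∈ Matrix.specialUnitaryGroup (Fin 2) ℂ :=
    fun v => exp_mem_specialUnitaryGroup_of_mem_lieSU (hρ8 v)
  obtain ⟨W, hW⟩ := exists_datumFamily_unitField F θ k K
  exact rootedReceipts_of_tokens_atScale_flatLogChart_modGauge F θ k K hk2 _ hT Kc range covers sol_of_isMinOn star_mem star_isMinOn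
    (eventually_unitField_mem F θ k K hρ hd) W hW
    (fun B => (bgSchemeOfRecord F 2 K (k + 1) Ω 1 dom levB Gp Δ2 a hposπ hposb hQ εC B₀ C₄ a₃ j a𝔄 ε₄).lieExpo (unitField F θ k K B))
    (chartCfg_unitField_eventuallyEq_expChart_ofRecord F θ K k Ω dom levB Gp Δ2 a hposπ hposb hQ εC B₀ C₄ a₃ j a𝔄 ε₄ htok)
    (lieExpo_unitField_zero_ofRecord F θ K k Ω dom levB Gp Δ2 a hposπ hposb hQ εC B₀ C₄ a₃ j a𝔄 ε₄ hT h1)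
    (contDiffAt_lieExpo_unitField_ofRecord_of_exp_mem F θ K k Ω dom levB Gp Δ2 a hposπ hposb hQ εC B₀ C₄ a₃ j a𝔄 ε₄ hρ hT h1 hWtok ha𝔄)
    hρ8

end RecordSchemeModGauge

end Summit.QuantumFields.YangMills.Theorems.K0AxCtabUniq

end
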